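import Summits.Ventures.PercRepro.MSTightConjTTheorem

/-!
# Theorem (T) in full generality: no hypothesis but `∩F ∉ F`, `∪F ∉ F`

Dossier proofs/MINE1-theoremS.md, Addendum 56 supplement 4. Addendum 45 §2 recorded the census
statement (T′): for ANY family `F` with `|F \\ F| = |F| + 1` whose core `∩F` and support `∪F` are
not members (twins and trivial elements allowed) and any `r` with `proj r F` tight,
`diffsY r F ⊆ diffsX r F`. Here it is a theorem (`diffsY_subset_diffsX_of_no_min_max`), with
«`∩F ∉ F`» and «`∪F ∉ F`» in the definition-free form «no minimum member» / «no maximum member».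
Proof: if `r` lies in every member or in no member, `Y = ∅`; otherwise remove the core
(`F' = {t \ c}` has the same differences, `diffs_image_sdiff_core`) and restrict to the support
through the transport layer (`famMap_subtype_image'`), where `conjT` applies.
-/

namespace PercRepro.MSTight

open Finset
open scoped FinsetFamily

section SubtypeGeneral

variable {α : Type*} [DecidableEq α]

/-- A family whose members lie in `{x | p x}` is the transport of its restriction to the subtype.
-/
theorem famMap_subtype_image' (p : α → Prop) [DecidablePred p] {G : Finset (Finset α)}
    (hG : ∀ s ∈ G, ∀ x ∈ s, p x) :
    famMap (Function.Embedding.subtype p) (G.image (Finset.subtype p)) = G := by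
  ext A
  rw [mem_famMap]
  constructor
  · rintro ⟨s, hs, rfl⟩
    obtain ⟨t, ht, rfl⟩ := mem_image.1 hs
    rw [subtype_map, filter_true_of_mem (p := p) (hG t ht)]
    exact ht
  · intro hA
    refine ⟨A.subtype p, mem_image_of_mem _ hA, ?_⟩
    rw [subtype_map, filter_true_of_mem (p := p) (hG A hA)]

/-- Membership in the restriction. -/
theorem mem_subtype_image' (p : α → Prop) [DecidablePred p] {G : Finset (Finset α)}
    (hG : ∀ s ∈ G, ∀ x ∈ s, p x) {s : Finset (Subtype p)} :
    s ∈ G.image (Finset.subtype p) ↔ s.map (Function.Embedding.subtype p) ∈ G := by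
  constructor
  · intro hs
    have h := map_mem_famMap_of_mem (e := Function.Embedding.subtype p) hs
    rwa [famMap_subtype_image' p hG] at h
  · intro hs
    rw [← famMap_subtype_image' p hG] at hs
    exact map_mem_famMap.1 hs

omit [DecidableEq α] in
/-- The image of `univ` of a subtype is the filter. -/
theorem univ_map_subtype [Fintype α] (p : α → Prop) [DecidablePred p] :
    (univ : Finset (Subtype p)).map (Function.Embedding.subtype p) = univ.filter p := by
  rw [← subtype_univ p, subtype_map]

end SubtypeGeneral

section CoreRemoval

variable {α : Type*} [DecidableEq α] {F : Finset (Finset α)} {c : Finset α}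

/-- Removing a set `c` contained in every member does not change the differences. -/
theorem diffs_image_sdiff_core (hc : ∀ t ∈ F, c ⊆ t) :
    (F.image fun t => t \ c) \\ (F.image fun t => t \ c) = F \\ F := by
  rw [diffs_image_sdiff]
  have key : ∀ d ∈ F \\ F, d \ c = d := by
    intro d hd
    obtain ⟨A, hA, B, hB, rfl⟩ := mem_diffs.1 hd
    ext x
    simp only [mem_sdiff]
    constructor
    · rintro ⟨⟨hxA, hxB⟩, -⟩
      exact ⟨hxA, hxB⟩
    · rintro ⟨hxA, hxB⟩
      exact ⟨⟨hxA, hxB⟩, fun hxc => hxB (hc B hB hxc)⟩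
  ext d
  simp only [mem_image]
  constructor
  · rintro ⟨d', hd', rfl⟩
    rw [key d' hd']
    exact hd'
  · intro hd
    exact ⟨d, hd, key d hd⟩

/-- Removing a set contained in every member is injective on the family. -/
theorem card_image_sdiff_core (hc : ∀ t ∈ F, c ⊆ t) :
    (F.image fun t => t \ c).card = F.card := by
  apply card_image_of_injOn
  intro t ht t' ht' h
  have h' : t \ c = t' \ c := h
  rw [mem_coe] at ht ht'
  rw [← sdiff_union_of_subset (hc t ht), ← sdiff_union_of_subset (hc t' ht'), h']

/-- Projection and core removal commute. -/
theorem proj_image_sdiff (r : α) (c : Finset α) (F : Finset (Finset α)) :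
    proj r (F.image fun t => t \ c) = (proj r F).image fun t => t \ c := by
  unfold proj
  rw [image_image, image_image]
  congr 1
  funext t
  simp only [Function.comp]
  ext x
  simp only [mem_erase, mem_sdiff]
  tauto

end CoreRemoval

section General

variable {α : Type*} [DecidableEq α] [Fintype α] {r : α} {F : Finset (Finset α)}

omit [Fintype α] in
/-- `Y = ∅` when `r` lies in every member. -/
theorem diffsY_eq_empty_of_forall_mem (h : ∀ t ∈ F, r ∈ t) : diffsY r F = ∅ := by
  rw [eq_empty_iff_forall_notMem]
  intro z hz
  obtain ⟨-, -, s, hs, -⟩ := mem_diffs.1 hz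
  exact (mem_part0.1 hs).2 (h _ (mem_part0.1 hs).1)

omit [Fintype α] in
/-- `Y = ∅` when `r` lies in no member. -/
theorem diffsY_eq_empty_of_forall_notMem (h : ∀ t ∈ F, r ∉ t) : diffsY r F = ∅ := by
  rw [eq_empty_iff_forall_notMem]
  intro z hz
  obtain ⟨t, ht, -, -, -⟩ := mem_diffs.1 hz
  exact h _ (mem_partr.1 ht).2 (mem_insert_self r t)

/-- **THEOREM (T), GENERAL FORM.** For any family `F` of Marica–Schönheim excess one with no
minimum and no maximum member (`∩F ∉ F`, `∪F ∉ F`) and any tightening direction `r`,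
`diffsY r F ⊆ diffsX r F`. -/
theorem diffsY_subset_diffsX_of_no_min_max (hF : (F \\ F).card = F.card + 1)
    (hmin : ∀ t ∈ F, ∃ t' ∈ F, ¬ t ⊆ t') (hmax : ∀ t ∈ F, ∃ t' ∈ F, ¬ t' ⊆ t)
    (hP : Tight (proj r F)) : diffsY r F ⊆ diffsX r F := by
  classical
  -- the trivial directions
  by_cases hrc : ∀ t ∈ F, r ∈ t
  · rw [diffsY_eq_empty_of_forall_mem hrc]
    exact empty_subset _
  by_cases hrs : ∀ t ∈ F, r ∉ t
  · rw [diffsY_eq_empty_of_forall_notMem hrs]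
    exact empty_subset _
  push Not at hrc hrs
  -- the core and the support
  set c : Finset α := univ.filter fun a => ∀ t ∈ F, a ∈ t with hcdef
  have hc : ∀ t ∈ F, c ⊆ t := fun t ht a ha => (mem_filter.1 ha).2 t ht
  set p : α → Prop := fun a => (∃ t ∈ F, a ∈ t) ∧ a ∉ c with hpdef
  set F' : Finset (Finset α) := F.image fun t => t \ c with hF'def
  have hF'p : ∀ s ∈ F', ∀ x ∈ s, p x := by
    intro s hs x hx
    obtain ⟨t, ht, rfl⟩ := mem_image.1 hs
    exact ⟨⟨t, ht, (mem_sdiff.1 hx).1⟩, (mem_sdiff.1 hx).2⟩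
  have hmap : famMap (Function.Embedding.subtype p) (F'.image (Finset.subtype p)) = F' :=
    famMap_subtype_image' p hF'p
  -- the differences of `F'` are those of `F`
  have hD : F' \\ F' = F \\ F := diffs_image_sdiff_core hc
  have hcard : F'.card = F.card := card_image_sdiff_core hc
  -- `r` is in the subtype
  obtain ⟨t₀, ht₀, hrt₀⟩ := hrc
  obtain ⟨t₁, ht₁, hrt₁⟩ := hrs
  have hrp : p r := ⟨⟨t₁, ht₁, hrt₁⟩, fun h => hrt₀ ((mem_filter.1 h).2 t₀ ht₀)⟩
  have hrc' : r ∉ c := hrp.2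
  -- hypotheses on the subtype
  have h1 : (F'.image (Finset.subtype p) \\ F'.image (Finset.subtype p)).card =
      (F'.image (Finset.subtype p)).card + 1 := by
    rw [← card_diffs_famMap_eq_iff (Function.Embedding.subtype p), hmap, hD, hcard]
    exact hF
  have h2 : (∅ : Finset (Subtype p)) ∉ F'.image (Finset.subtype p) := by
    intro h
    have h' := (mem_subtype_image' p hF'p).1 h
    rw [map_empty] at h'
    obtain ⟨t, ht, hte⟩ := mem_image.1 h'
    have htc : t = c := Subset.antisymm (sdiff_eq_empty_iff_subset.1 hte) (hc t ht)
    obtain ⟨t', ht', hnot⟩ := hmin t ht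
    exact hnot (htc ▸ hc t' ht')
  have h3 : (univ : Finset (Subtype p)) ∉ F'.image (Finset.subtype p) := by
    intro h
    have h' := (mem_subtype_image' p hF'p).1 h
    rw [univ_map_subtype] at h'
    obtain ⟨t, ht, hte⟩ := mem_image.1 h'
    obtain ⟨t', ht', hnot⟩ := hmax t ht
    apply hnot
    intro x hx
    by_cases hxc : x ∈ c
    · exact hc t ht hxc
    · have : x ∈ t \ c := by
        rw [hte, mem_filter]
        exact ⟨mem_univ x, ⟨t', ht', hx⟩, hxc⟩
      exact (mem_sdiff.1 this).1
  have h4 : ∀ x : Subtype p, ∃ t ∈ F'.image (Finset.subtype p), x ∉ t := by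
    intro x
    have hxc : x.1 ∉ c := x.2.2
    rw [hcdef, mem_filter, not_and] at hxc
    push Not at hxc
    obtain ⟨t, ht, hxt⟩ := hxc (mem_univ _)
    refine ⟨(t \ c).subtype p, mem_image_of_mem _ (mem_image_of_mem _ ht), ?_⟩
    rw [mem_subtype]
    exact fun h => hxt (mem_sdiff.1 h).1
  have h5 : ∀ x : Subtype p, ∃ t ∈ F'.image (Finset.subtype p), x ∈ t := by
    intro x
    obtain ⟨t, ht, hxt⟩ := x.2.1
    exact ⟨(t \ c).subtype p, mem_image_of_mem _ (mem_image_of_mem _ ht),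
      mem_subtype.2 (mem_sdiff.2 ⟨hxt, x.2.2⟩)⟩
  have h6 : Tight (proj (⟨r, hrp⟩ : Subtype p) (F'.image (Finset.subtype p))) := by
    rw [← tight_famMap_iff (Function.Embedding.subtype p), ← proj_famMap, hmap]
    have e : proj r F' = (proj r F).image fun t => t \ c := proj_image_sdiff r c F
    have hcP : ∀ t ∈ proj r F, c ⊆ t := by
      intro t ht
      obtain ⟨B, hB, rfl⟩ := mem_proj.1 ht
      intro a ha
      exact mem_erase.2 ⟨fun h => hrc' (h ▸ ha), hc B hB ha⟩
    show (proj r F' \\ proj r F').card = (proj r F').card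
    rw [e, diffs_image_sdiff_core hcP, card_image_sdiff_core hcP]
    exact hP
  have hT := conjT (F'.image (Finset.subtype p)) ⟨r, hrp⟩ h1 h2 h3 h4 h5 h6
  have hT' := diffsY_subset_diffsX_of_famMap (e := Function.Embedding.subtype p) hT
  rw [hmap] at hT'
  -- back to `F`: same differences, same `r`
  intro z hz
  have hz' : z ∈ diffsY r F' := by
    rw [mem_diffsY_iff, hD]
    exact mem_diffsY_iff.1 hz
  have hx := hT' hz'
  rw [mem_diffsX_iff, hD] at hx
  exact mem_diffsX_iff.2 hx

end General

end PercRepro.MSTight
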